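import Literature.Claims.NS.Washburn2026
import Literature.Analysis.FluidPDE.RotatingStrainFlows
import Literature.Analysis.FluidPDE.BurgersVortexLayerSteady
import HarnessLib

/-!
# C159 `Washburn2026` — SOLO REFUTATION (ns-claims-refuter-3 g4): three binders of §10's chain are false

Washburn, *Global Regularity for the Three-Dimensional Incompressible Navier–Stokes Equations via a
Parabolic Liouville Theorem and Vorticity-Direction Ledger Dynamics* (Zenodo 19490305, 2026, 18 pp.;
cell C159; skeleton `Literature/Claims/NS/Washburn2026.lean`, typist-7 g7, tree sha16 24ae544e53717cdf).

The skeleton's composition `noBlowup_of_steps : Lemma34_Extraction → Theorem75_const → Theorem86_RhoOne →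
Cor87_RigidRotation → Theorem911_NoRigidLimit → NoBlowup` consumes, for EVERY member of the running-max
ancient element's class `IsAE ν` (classical on `(−∞,0]`, smooth slices, `ρ ≤ 1`, `ρ(0,0) = 1`,
`sup_x ρ(·,t) = 1`), the §8 form of Thm 7.5 («ξ^∞ ≡ b₀», p.12 l.84–86), Thm 8.6 («ρ^∞ ≡ 1», p.13
l.23–30) and Cor 8.7 («u^∞ = ½(−x₂,x₁,0) + c(t)», p.13 l.31–38). Each is refuted here by an EXACT
classical Navier–Stokes solution lying in `IsAE ν` (all from accepted tree files:
`RotatingStrainFlows` = Majda–Bertozzi 2002 Prop. 1.5 «`v = ½ω(t) × x + 𝒟(t)x`, `ω̇ = 𝒟ω`»;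
`BurgersVortexLayerSteady` = the Burgers vortex layer):

* **`not_Theorem75_const`** (TOKEN; Step 8, §8 form of Thm 7.5, p.12 l.84–86 ← p.9 l.65–66): the
  direction-ROTATING linear flow `W6 = 𝒟(t)x + ½ω(t) × x`, `ω(t) = (cos t, sin t, 0)`,
  `𝒟 = ω ⊗ ω̇ + ω̇ ⊗ ω` (symmetric, trace-free, `𝒟ω = ω̇ ⊥ ω`): `|ω| ≡ 1`, `∇ξ ≡ 0` at every time
  (the LITERAL Thm 7.5 holds on it: `gradXi_W6`), yet `ξ(·,0) = e₀ ≠ −e₁ = ξ(·,−π/2)` — no constant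
  `b₀`. The printed passage «∇ξ^∞ ≡ 0 … From now on we assume the conclusion of Theorem 7.5:
  ξ^∞ ≡ b₀ for some constant b₀ ∈ S²» drops the time dependence of the direction.
* **`not_Theorem86_RhoOne`** (Step 9, Thm 8.6 with Lemmas 8.2/8.3): the Burgers vortex layer
  `W4 ν = (−2νx₀, V(x₀), 2νx₂)`, `V′(s) = e^{−s²}`: `ω = e^{−x₀²} e₃`, `ξ ≡ e₃`, `sup ρ = ρ(0) = 1`, but
  `ρ(e₀) = e^{−1} ≠ 1` (its `u₃ = 2νx₂` has `b ≡ 2ν ≠ 0`: Lemma 8.3 «b ≡ 0» and Lemma 8.2's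
  «ḃ + b² = 0» fail as printed).
* **`not_Cor87_RigidRotation`** (Step 10, Cor 8.7): the strained rotation
  `W1 1 = (x₀ − ½x₁, ½x₀ − x₁, 0)` (rotation `½e₃ × x` plus the plane strain `diag(1, −1, 0)`): `ω ≡ e₃`, `ρ ≡ 1`, `ξ ≡ e₃`, yet `u(e₀)·e₀ = 1 ≠ −1 = u(−e₀)·e₀` while
  `½b₀ × x + c(t)` gives equal values — not a rigid rotation plus drift (the typist's docstring flags
  the same family).

Not refuted (and not refutable by explicit members, all of which have spatially constant direction):
Steps 1–7 and the literal Step 8 `Theorem75_DirectionConstancy`; Step 3 `Theorem611_TFPinch` is true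
cosh-calculus; Step 11 is about undefined ledger objects. Class (MAP-SCHEMA): FALSE LEMMA / countermodel.
Records-grade companions NOT in this file (scratch `claims/Washburn2026/kit-refuter3g4/Washburn2026Records.lean`,
farm-checked by hash): `W2` stretched rotation (`ω = eᵗe₃`, outside `IsAE` only by the sup-freeze clause), `W3` rigid
rotation, `W5 ν κ` thin Burgers layers (`‖∇ω‖ = 2κ/e` at `x₀ = 1/κ` with `‖ω‖ ≤ 1`: Lemma 3.5's universal `C_Ser`,
p.5 l.60–62, and Lemma 7.1's universal `δ`, p.9 l.3–15, fail as printed).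

Kit of record: `claims/Washburn2026/kit-refuter3g4/SoloRefuteWashburn2026.lean` (filed UNCHANGED by the
SALVAGE seat). WHAT THIS IS NOT: not a claim about NS regularity or blow-up; not a claim about any
author beyond the typed locator.
-/

set_option linter.dupNamespace false

noncomputable section

open Real Set Function InnerProductSpace
open scoped RealInnerProductSpace ContDiff Topology

namespace Summit.NavierStokesRegularity.NavierStokesRegularity.Theorems.Washburn2026

open Literature.Analysis.FluidPDE Literature.Analysis.FluidPDE.RotatingStrain
open Literature.Claims.NS.Washburn2026 (E3)


/-- The third basis vector `e₃ = single 2 1`. -/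
def e3 : E3 := EuclideanSpace.single 2 1

/-- `‖e₃‖ = 1`. [folklore] -/
theorem norm_e3 : ‖e3‖ = 1 := by simp [e3]

/-- `e₃ ≠ 0`. [folklore] -/
theorem e3_ne_zero : e3 ≠ 0 := fun h => by simpa [h] using norm_e3

/-! ### W1: the strained rotation (steady linear flow, `ω ≡ e₃`) -/

/-- `W1 d (t, x) = (d x₀ − ½ x₁, ½ x₀ − d x₁, 0)`: Majda–Bertozzi (1.24) with `𝒟 = diag(d, −d, 0)`, `ω ≡ e₃`. [cite: MajdaBertozziCUP2002, §1.4 Prop. 1.5] -/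
def W1 (d : ℝ) : ℝ → E3 → E3 :=
  velocity (fun _ => jet (-d) d) (rotatingJetVorticity 1 (-d) d)

/-- The pressure of `W1 d`. [cite: MajdaBertozziCUP2002, §1.4 Prop. 1.5] -/
def P1 (d : ℝ) : ℝ → E3 → ℝ :=
  pressure (fun _ => jet (-d) d) (rotatingJetVorticity 1 (-d) d)

/-- `W1 d` is a classical Navier–Stokes solution on `ℝ³ × ℝ` for every viscosity. [cite: MajdaBertozziCUP2002, §1.4 Example 1.4] -/
theorem W1_sol (d ν : ℝ) : IsClassicalNSSolutionOn univ ν 0 (W1 d) (P1 d) :=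
  isClassicalNSSolutionOn_rotatingJet 1 (-d) d ν

/-- Components of `W1 d`. [folklore] -/
theorem W1_apply (d t : ℝ) (x : E3) :
    W1 d t x = !₂[d * x 0 - 1 / 2 * x 1, 1 / 2 * x 0 - d * x 1, 0] := by
  rw [W1, velocity_rotatingJet]
  ext i
  fin_cases i <;> simp

/-- `curl (W1 d)(t) ≡ e₃`. [folklore] -/
theorem curl_W1 (d t : ℝ) (x : E3) : curl (W1 d t) x = e3 := by
  rw [W1, curl_rotatingJet]
  simp [e3]

/-! ### W4: the normalised Burgers vortex layer (`γ = 2ν`, `ΔU = √π`) -/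

/-- `W4 ν (t, x) = (−2ν x₀, V(x₀), 2ν x₂)` with `V' = e^{−s²}`: the Burgers layer in the plane strain of rate `2ν`. [folklore] -/
def W4 (ν : ℝ) : ℝ → E3 → E3 := fun _ => burgersLayer (2 * ν) ν (Real.sqrt Real.pi)

/-- The pressure of `W4 ν`. [folklore] -/
def P4 (ν : ℝ) : ℝ → E3 → ℝ := fun _ => burgersLayerPressure (2 * ν)

/-- `W4 ν` is a (steady) classical Navier–Stokes solution on `ℝ³ × ℝ` with viscosity `ν`. [folklore] -/
theorem W4_sol (ν : ℝ) : IsClassicalNSSolutionOn univ ν 0 (W4 ν) (P4 ν) :=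
  isSteadyClassicalNS_iff_const.1 (burgersLayer_isSteadyClassicalNS (2 * ν) ν (Real.sqrt Real.pi))

/-- For `ν > 0` the layer rate of `(γ, ν) = (2ν, ν)` is `κ = 1`. [folklore] -/
theorem rate_eq_one {ν : ℝ} (hν : 0 < ν) : burgersLayerRate (2 * ν) ν = 1 := by
  rw [burgersLayerRate, show 2 * ν / (2 * ν) = (1 : ℝ) by field_simp, Real.sqrt_one]

/-- `V'(s) = e^{−s²}` for the normalised layer (`ν > 0`). [folklore] -/
theorem profileD_eq {ν : ℝ} (hν : 0 < ν) (s : ℝ) :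
    burgersLayerProfileD (2 * ν) ν (Real.sqrt Real.pi) s = exp (-s ^ 2) := by
  have hpi : Real.sqrt Real.pi ≠ 0 := (Real.sqrt_pos.2 Real.pi_pos).ne'
  rw [burgersLayerProfileD, rate_eq_one hν, div_self hpi]
  simp

/-- `curl (W4 ν)(t, x) = e^{−x₀²} e₃` (`ν > 0`). [folklore] -/
theorem curl_W4 {ν : ℝ} (hν : 0 < ν) (t : ℝ) (x : E3) : curl (W4 ν t) x = exp (-(x 0) ^ 2) • e3 := by
  show curl (burgersLayer (2 * ν) ν (Real.sqrt Real.pi)) x = _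
  rw [curl_burgersLayer, profileD_eq hν, e3]

/-- `‖curl (W4 ν)(t, x)‖ = e^{−x₀²} ≤ 1`. [folklore] -/
theorem norm_curl_W4 {ν : ℝ} (hν : 0 < ν) (t : ℝ) (x : E3) : ‖curl (W4 ν t) x‖ = exp (-(x 0) ^ 2) := by
  rw [curl_W4 hν, norm_smul, norm_e3, mul_one, Real.norm_eq_abs, abs_of_pos (exp_pos _)]

/-- Components of `W4 ν`. [folklore] -/
theorem W4_apply (ν t : ℝ) (x : E3) :
    W4 ν t x = !₂[-(2 * ν) * x 0, burgersLayerProfile (2 * ν) ν (Real.sqrt Real.pi) (x 0), 2 * ν * x 2] := by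
  ext i
  fin_cases i <;> simp [W4, burgersLayer, planeStrain, linearStrain, burgersLayerVelocity]

/-! ### W6: the direction-rotating linear flow `u = 𝒟(t)x + ½ω(t) × x`, `ω(t) = (cos t, sin t, 0)` -/

/-- The strain `𝒟(t) = ω ⊗ ω' + ω' ⊗ ω` for `ω(t) = (cos t, sin t, 0)`: symmetric, trace-free, with
`𝒟(t)ω(t) = ω'(t) ⊥ ω(t)` (no stretching, pure turning). [cite: MajdaBertozziCUP2002, §1.4 Prop. 1.5 eq. (1.23)] -/
def D6 (t : ℝ) : Matrix (Fin 3) (Fin 3) ℝ :=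
  !![-Real.sin (2 * t), Real.cos (2 * t), 0; Real.cos (2 * t), Real.sin (2 * t), 0; 0, 0, 0]

/-- The unit vorticity `ω(t) = cos t e₀ + sin t e₁`, turning at unit angular speed. [folklore] -/
def w6 (t : ℝ) : E3 := Real.cos t • EuclideanSpace.single 0 1 + Real.sin t • EuclideanSpace.single 1 1

/-- `W6`: the linear flow (1.24) with strain `D6` and vorticity `w6`. [cite: MajdaBertozziCUP2002, §1.4 Prop. 1.5 eq. (1.24)] -/
def W6 : ℝ → E3 → E3 := velocity D6 w6

/-- The pressure of `W6`. [cite: MajdaBertozziCUP2002, §1.4 Prop. 1.5 eq. (1.24)] -/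
def P6 : ℝ → E3 → ℝ := pressure D6 w6

/-- The entries of `D6` are smooth in time. [folklore] -/
theorem contDiff_D6 (i j : Fin 3) : ContDiff ℝ ∞ fun s => D6 s i j := by
  fin_cases i <;> fin_cases j <;> simp [D6] <;> fun_prop

/-- `D6(t)` is symmetric. [folklore] -/
theorem D6_isSymm (t : ℝ) : (D6 t).IsSymm := by
  refine Matrix.IsSymm.ext fun i j => ?_
  fin_cases i <;> fin_cases j <;> simp [D6]

/-- `D6(t)` is trace-free. [folklore] -/
theorem D6_trace (t : ℝ) : (D6 t).trace = 0 := by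
  rw [Matrix.trace_fin_three]
  simp [D6]

/-- `𝒟(t)ω(t) = ω'(t) = −sin t e₀ + cos t e₁`. [folklore] -/
theorem lin_D6_w6 (t : ℝ) :
    lin (D6 t) (w6 t) = (-Real.sin t) • EuclideanSpace.single 0 1 + Real.cos t • EuclideanSpace.single 1 1 := by
  have h := Real.sin_sq_add_cos_sq t
  ext i
  fin_cases i
  · simp [lin_apply, D6, w6, Real.sin_two_mul, Real.cos_two_mul]; ring
  · simp [lin_apply, D6, w6, Real.sin_two_mul, Real.cos_two_mul]; linear_combination 2 * Real.cos t * h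
  · simp [lin_apply, D6, w6]

/-- The vorticity ODE (1.23) `ω' = 𝒟ω` holds for `(D6, w6)`. [cite: MajdaBertozziCUP2002, §1.4 Prop. 1.5 eq. (1.23)] -/
theorem hasDerivAt_w6 (t : ℝ) : HasDerivAt w6 (lin (D6 t) (w6 t)) t := by
  rw [lin_D6_w6]
  exact ((Real.hasDerivAt_cos t).smul_const _).add ((Real.hasDerivAt_sin t).smul_const _)

/-- `W6` is a classical Navier–Stokes solution on `ℝ³ × ℝ` for every viscosity. [cite: MajdaBertozziCUP2002, §1.4 Prop. 1.5] -/
theorem W6_sol (ν : ℝ) : IsClassicalNSSolutionOn univ ν 0 W6 P6 :=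
  RotatingStrain.isClassicalNSSolutionOn contDiff_D6 D6_isSymm D6_trace hasDerivAt_w6 ν

/-- The slices of `W6` are smooth. [folklore] -/
theorem contDiff_W6 (t : ℝ) : ContDiff ℝ ∞ (W6 t) := contDiff_velocity t

/-- `curl W6(t, ·) ≡ ω(t)`: spatially constant vorticity. [cite: MajdaBertozziCUP2002, §1.4 Prop. 1.5] -/
theorem curl_W6 (t : ℝ) (x : E3) : curl (W6 t) x = w6 t := curl_velocity (D6_isSymm t) x

/-- `|ω(t)| = 1` for all `t`. [folklore] -/
theorem norm_w6 (t : ℝ) : ‖w6 t‖ = 1 := by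
  rw [EuclideanSpace.norm_eq, Fin.sum_univ_three]
  simp [w6]

/-- `|curl W6| ≡ 1`. [folklore] -/
theorem norm_curl_W6 (t : ℝ) (x : E3) : ‖curl (W6 t) x‖ = 1 := by rw [curl_W6, norm_w6]

/-- `ω(0) · e₀ = 1`. [folklore] -/
theorem w6_zero_apply : w6 0 0 = 1 := by simp [w6]

/-- `ω(−π/2) · e₀ = 0`: a quarter period earlier the vorticity points along `−e₁`. [folklore] -/
theorem w6_neg_pi_div_two_apply : w6 (-(Real.pi / 2)) 0 = 0 := by simp [w6]

/-! ### Restrictions to the ancient time sets -/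

/-- A solution on `ℝ` restricts to `(−∞, 0]`. [folklore] -/
theorem sol_Iic {ν : ℝ} {u : ℝ → E3 → E3} {p : ℝ → E3 → ℝ} (h : IsClassicalNSSolutionOn univ ν 0 u p) :
    IsClassicalNSSolutionOn (Iic 0) ν 0 u p :=
  h.mono (subset_univ _) (uniqueDiffOn_Iic 0)

/-- Slices of a classical solution on `ℝ³ × ℝ` are smooth. [folklore] -/
theorem smooth_slice {ν : ℝ} {u : ℝ → E3 → E3} {p : ℝ → E3 → ℝ} (h : IsClassicalNSSolutionOn univ ν 0 u p)
    (t : ℝ) : ContDiff ℝ ∞ (u t) :=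
  h.smooth_velocity.contDiff_slice (mem_univ t)

/-! ## Membership in the typed class `IsAE` and the direction field `ξ` of the witnesses -/

open Literature.Claims.NS.Washburn2026 (rho xi gradXi rigid IsAE Theorem75_const Theorem75_DirectionConstancy
  Theorem86_RhoOne Cor87_RigidRotation)

/-- `ρ ≡ 1` for the direction-rotating linear flow. [folklore] -/
theorem rho_W6 (t : ℝ) (x : E3) : rho W6 t x = 1 := norm_curl_W6 t x

/-- `W6 ∈ IsAE ν` for every `ν`. [cite: Washburn2026, Lemma 3.4 p.5 l.38–59] -/
theorem isAE_W6 (ν : ℝ) : IsAE ν W6 P6 where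
  classical := sol_Iic (W6_sol ν)
  smooth t _ := contDiff_W6 t
  vort_le t _ x := (rho_W6 t x).le
  origin := rho_W6 0 0
  sup_one t _ ε hε := ⟨0, by rw [rho_W6]; linarith⟩

/-- `ξ(·,t) ≡ ω(t)` for `W6`. [folklore] -/
theorem xi_W6 (t : ℝ) (x : E3) : xi W6 t x = w6 t := by
  unfold xi
  rw [rho_W6, inv_one, one_smul, curl_W6]

/-- The LITERAL Thm 7.5 holds on `W6`: `∇ξ ≡ 0` (the direction is spatially constant at each time).
[cite: Washburn2026, Thm 7.5 p.9 l.65–66] -/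
theorem gradXi_W6 (t : ℝ) (x : E3) : gradXi W6 t x = 0 := by
  unfold gradXi
  rw [show xi W6 t = fun _ => w6 t from funext (xi_W6 t)]
  exact fderiv_const_apply (w6 t)

/-- `ρ(x) = e^{−x₀²}` for the Burgers layer `W4 ν`. [folklore] -/
theorem rho_W4 {ν : ℝ} (hν : 0 < ν) (t : ℝ) (x : E3) : rho (W4 ν) t x = exp (-(x 0) ^ 2) :=
  norm_curl_W4 hν t x

/-- `W4 ν ∈ IsAE ν` (`ν > 0`). [cite: Washburn2026, Lemma 3.4 p.5 l.38–59] -/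
theorem isAE_W4 {ν : ℝ} (hν : 0 < ν) : IsAE ν (W4 ν) (P4 ν) where
  classical := sol_Iic (W4_sol ν)
  smooth t _ := smooth_slice (W4_sol ν) t
  vort_le t _ x := by
    rw [rho_W4 hν]
    exact exp_le_one_iff.2 (neg_nonpos.2 (sq_nonneg _))
  origin := by rw [rho_W4 hν]; simp
  sup_one t _ ε hε := ⟨0, by rw [rho_W4 hν]; simp; linarith⟩

/-- `ξ ≡ e₃` for the Burgers layer. [folklore] -/
theorem xi_W4 {ν : ℝ} (hν : 0 < ν) (t : ℝ) (x : E3) : xi (W4 ν) t x = e3 := by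
  unfold xi
  rw [rho_W4 hν, curl_W4 hν, smul_smul, inv_mul_cancel₀ (exp_pos _).ne', one_smul]

/-- `ρ ≡ 1` for the strained rotation `W1 d`. [folklore] -/
theorem rho_W1 (d t : ℝ) (x : E3) : rho (W1 d) t x = 1 := by
  unfold rho
  rw [curl_W1, norm_e3]

/-- `W1 d ∈ IsAE ν`. [cite: Washburn2026, Lemma 3.4 p.5 l.38–59] -/
theorem isAE_W1 (d ν : ℝ) : IsAE ν (W1 d) (P1 d) where
  classical := sol_Iic (W1_sol d ν)
  smooth t _ := contDiff_velocity t
  vort_le t _ x := (rho_W1 d t x).le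
  origin := rho_W1 d 0 0
  sup_one t _ ε hε := ⟨0, by rw [rho_W1]; linarith⟩

/-- `ξ ≡ e₃` for the strained rotation. [folklore] -/
theorem xi_W1 (d t : ℝ) (x : E3) : xi (W1 d) t x = e3 := by
  unfold xi
  rw [rho_W1, inv_one, one_smul, curl_W1]

/-! ## Refutations -/

/-- **TOKEN — Step 8 (§8 form of Theorem 7.5, p.12 l.84–86 «we assume the conclusion of Theorem 7.5:
ξ^∞ ≡ b₀ for some constant b₀ ∈ S²», ← Thm 7.5 p.9 l.65–66 «∇ξ^∞ ≡ 0») is FALSE on the class:**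
the direction-rotating linear flow `W6` is an ancient element with `∇ξ ≡ 0` whose direction is `e₀` at
`t = 0` and `−e₁` at `t = −π/2`. Binder `h75` of `noBlowup_of_steps`. [cite: Washburn2026, §8 p.12 l.84–86; Thm 7.5 p.9 l.65–66] [cite: MajdaBertozziCUP2002, §1.4 Prop. 1.5] -/
theorem not_Theorem75_const : ¬ Theorem75_const := by
  intro h
  obtain ⟨b₀, -, hb⟩ := h 1 one_pos W6 P6 (isAE_W6 1)
  have hπ : -(Real.pi / 2) ≤ 0 := by have := Real.pi_pos; linarith
  have h0 := hb 0 le_rfl 0 (by rw [rho_W6]; exact one_pos)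
  have h1 := hb (-(Real.pi / 2)) hπ 0 (by rw [rho_W6]; exact one_pos)
  rw [xi_W6] at h0 h1
  have h2 := congrArg (fun v : E3 => v 0) (h0.trans h1.symm)
  simp only [w6_zero_apply, w6_neg_pi_div_two_apply] at h2
  exact one_ne_zero h2

/-- The literal face and the §8 face of Thm 7.5 DIFFER on the class: `W6` satisfies the former's
conclusion and violates the latter's. [cite: Washburn2026, Thm 7.5 p.9 l.65–66; §8 p.12 l.84–86] -/
theorem literal75_holds_const75_fails_W6 :
    (∀ t : ℝ, t ≤ 0 → ∀ x, 0 < rho W6 t x → gradXi W6 t x = 0) ∧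
      ¬ ∃ b₀ : E3, ‖b₀‖ = 1 ∧ ∀ t : ℝ, t ≤ 0 → ∀ x, 0 < rho W6 t x → xi W6 t x = b₀ := by
  refine ⟨fun t _ x _ => gradXi_W6 t x, ?_⟩
  rintro ⟨b₀, -, hb⟩
  have hπ : -(Real.pi / 2) ≤ 0 := by have := Real.pi_pos; linarith
  have h0 := hb 0 le_rfl 0 (by rw [rho_W6]; exact one_pos)
  have h1 := hb (-(Real.pi / 2)) hπ 0 (by rw [rho_W6]; exact one_pos)
  rw [xi_W6] at h0 h1
  have h2 := congrArg (fun v : E3 => v 0) (h0.trans h1.symm)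
  simp only [w6_zero_apply, w6_neg_pi_div_two_apply] at h2
  exact one_ne_zero h2

/-- **Step 9 (Theorem 8.6 «ρ^∞ ≡ 1», p.13 l.23–30, via Lemmas 8.2–8.3) is FALSE on the class:** the
Burgers vortex layer has constant direction `e₃`, `sup ρ = ρ(0) = 1`, and `ρ(e₀) = e^{−1} ≠ 1`.
Binder `h86` of `noBlowup_of_steps`. [cite: Washburn2026, Thm 8.6 p.13 l.23–30; Lemma 8.2, Lemma 8.3 p.12 l.93 – p.13 l.9] -/
theorem not_Theorem86_RhoOne : ¬ Theorem86_RhoOne := by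
  intro h
  have h1 := h 1 one_pos (W4 1) (P4 1) (isAE_W4 one_pos) e3 norm_e3
    (fun t _ x _ => xi_W4 one_pos t x) 0 le_rfl (EuclideanSpace.single 0 1)
  rw [rho_W4 one_pos] at h1
  have h2 : exp (-((EuclideanSpace.single (0 : Fin 3) (1 : ℝ) : E3) 0) ^ 2) = exp (-1) := by simp
  rw [h2] at h1
  exact (exp_lt_one_iff.2 (by norm_num : (-1 : ℝ) < 0)).ne h1

/-- **Step 10 (Corollary 8.7 «u^∞ = ½(−x₂, x₁, 0) + c(t)», p.13 l.31–38) is FALSE on the class:**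
the strained rotation `W1 1 = (x₀ − ½x₁, ½x₀ − x₁, 0)` has `ρ ≡ 1`, `ξ ≡ e₃` and is not a rigid
rotation plus a drift (`u(e₀)·e₀ = 1`, `u(−e₀)·e₀ = −1`). Binder `h87` of `noBlowup_of_steps`.
[cite: Washburn2026, Cor 8.7 p.13 l.31–38] [cite: MajdaBertozziCUP2002, §1.4 Prop. 1.5] -/
theorem not_Cor87_RigidRotation : ¬ Cor87_RigidRotation := by
  intro h
  obtain ⟨c, hc⟩ := h 1 one_pos (W1 1) (P1 1) (isAE_W1 1 1) e3 norm_e3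
    (fun t _ x _ => xi_W1 1 t x) (fun t _ x => rho_W1 1 t x)
  have h1 := congrArg (fun v : E3 => v 0) (hc 0 le_rfl (EuclideanSpace.single 0 1))
  have h2 := congrArg (fun v : E3 => v 0) (hc 0 le_rfl (-EuclideanSpace.single 0 1))
  simp [W1_apply, rigid, Literature.Claims.NS.Washburn2026.cross, e3] at h1 h2
  linarith

/-- Three of the five binders of `noBlowup_of_steps` are false. [cite: Washburn2026, §10 p.15 l.9–26] -/
theorem three_binders_false : ¬ Theorem75_const ∧ ¬ Theorem86_RhoOne ∧ ¬ Cor87_RigidRotation :=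
  ⟨not_Theorem75_const, not_Theorem86_RhoOne, not_Cor87_RigidRotation⟩

end Summit.NavierStokesRegularity.NavierStokesRegularity.Theorems.Washburn2026

end
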